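import Literature.NumberTheory.EllipticCurves.Gamma0FundamentalDomain
import Literature.NumberTheory.EllipticCurves.HalfIntegralWeightThetaTransformation
import HarnessLib

/-!
# `Γ₀(N)⁺ = Γ₀(N) ∩ Γ₁(4)` acts freely on `ℍ`

[[cite: DiamondShurman2005, §2.3 (elliptic points), Ex. 2.3.7]] — for the unfolding of
Shintani's theta lift on `Γ₀(64)⁺` (`Gamma0FundamentalDomain`) the stabiliser of a DEFINITE
lattice vector is the stabiliser of its root in `ℍ`; we PROVE that it is trivial:

* `trace_mod_four_of_mem_Gamma1` — `a + d ≡ 2 (mod 4)` on `Γ₁(4)`;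
* `trace_sq_lt_four_of_smul_eq` — an element `γ ≠ ±1` of `SL₂(ℤ)` with a fixed point in `ℍ` has
  `(a + d)² < 4` (real and imaginary parts of `a w + b = w(c w + d)`);
* **`eq_one_of_mem_Gamma0Plus_of_smul_eq`**, `stabilizer_Gamma0Plus_eq_bot` — hence
  `γ ∈ Γ₀(N)⁺`, `γ w = w` force `γ = 1` (`-1 ∉ Γ₀(N)⁺`): `Γ₀(N)⁺` has no elliptic elements.

No named facts, no definitions.
-/

noncomputable section

open scoped MatrixGroups
open UpperHalfPlane hiding I
open Complex CongruenceSubgroup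

namespace Literature.NumberTheory.EllipticCurves.ModularForms

/-- Elements of `Γ₁(4)` have trace `≡ 2 (mod 4)`. [folklore] -/
theorem trace_mod_four_of_mem_Gamma1 {γ : SL(2, ℤ)} (hγ : γ ∈ Gamma1 4) :
    ((γ 0 0 + γ 1 1 : ℤ) : ZMod 4) = 2 := by
  rw [Gamma1_mem] at hγ
  push_cast
  rw [hγ.1, hγ.2.1]
  rfl

/-- **A non-central element of `SL₂(ℤ)` fixing a point of `ℍ` has `(a + d)² < 4`.** [folklore] -/
theorem trace_sq_lt_four_of_smul_eq {γ : SL(2, ℤ)} {w : ℍ} (hfix : γ • w = w) (h1 : γ ≠ 1)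
    (h2 : γ ≠ -1) : (γ 0 0 + γ 1 1 : ℤ) ^ 2 < 4 := by
  have hdet : (γ 0 0 : ℤ) * γ 1 1 - γ 0 1 * γ 1 0 = 1 := by
    have := Matrix.det_fin_two (γ : Matrix (Fin 2) (Fin 2) ℤ)
    rw [γ.det_coe] at this
    linarith
  -- the fixed-point equation `c w² + (d - a) w - b = 0`
  have hw : ((γ • w : ℍ) : ℂ) = (w : ℂ) := by rw [hfix]
  rw [coe_smul_eq'] at hw
  have hden : ((γ 1 0 : ℤ) : ℂ) * (w : ℂ) + ((γ 1 1 : ℤ) : ℂ) ≠ 0 := by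
    have h := UpperHalfPlane.denom_ne_zero (γ : GL (Fin 2) ℝ) w
    rw [ModularGroup.denom_apply] at h
    exact_mod_cast h
  rw [div_eq_iff hden] at hw
  -- `hw : a w + b = w (c w + d)`
  by_cases hc : (γ 1 0 : ℤ) = 0
  · -- `c = 0`: `a d = 1`, `a = d = ±1`, `(d - a) w = b` forces `b = 0`, so `γ = ±1`
    exfalso
    rw [hc, mul_zero, sub_zero] at hdet
    rcases Int.eq_one_or_neg_one_of_mul_eq_one hdet with ha | ha
    · have hd : (γ 1 1 : ℤ) = 1 := by rw [ha] at hdet; linarith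
      have hb : (γ 0 1 : ℤ) = 0 := by
        rw [ha, hd, hc] at hw
        push_cast at hw
        have : ((γ 0 1 : ℤ) : ℂ) = 0 := by linear_combination hw
        exact_mod_cast this
      apply h1
      ext i j
      fin_cases i <;> fin_cases j <;> simp [ha, hb, hc, hd]
    · have hd : (γ 1 1 : ℤ) = -1 := by rw [ha] at hdet; linarith
      have hb : (γ 0 1 : ℤ) = 0 := by
        rw [ha, hd, hc] at hw
        push_cast at hw
        have : ((γ 0 1 : ℤ) : ℂ) = 0 := by linear_combination hw
        exact_mod_cast this
      apply h2
      ext i j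
      fin_cases i <;> fin_cases j <;> simp [ha, hb, hc, hd]
  · -- `c ≠ 0`: real and imaginary parts of `a w + b = w (c w + d)` with `w = x + iy`, `y > 0`:
    -- `a y = 2 c x y + d y` gives `2 c x = a - d`, and then the real part gives
    -- `4 c² y² = 4 - (a + d)²`.
    set x : ℝ := (w : ℂ).re with hx
    set y : ℝ := (w : ℂ).im with hy
    have hypos : 0 < y := by rw [hy, UpperHalfPlane.coe_im]; exact w.im_pos
    have hR : (γ 0 0 : ℝ) * x + γ 0 1 = γ 1 0 * x ^ 2 - γ 1 0 * y ^ 2 + γ 1 1 * x := by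
      have h := congrArg Complex.re hw
      simp only [Complex.add_re, Complex.mul_re, Complex.mul_im, Complex.add_im, Complex.intCast_re,
        Complex.intCast_im, zero_mul, sub_zero, add_zero] at h
      rw [← hx, ← hy] at h
      nlinarith [h]
    have hI : (γ 0 0 : ℝ) * y = 2 * γ 1 0 * x * y + γ 1 1 * y := by
      have h := congrArg Complex.im hw
      simp only [Complex.add_re, Complex.mul_re, Complex.mul_im, Complex.add_im, Complex.intCast_re,
        Complex.intCast_im, zero_mul, sub_zero, add_zero] at h
      rw [← hx, ← hy] at h
      nlinarith [h]
    have hxc : 2 * (γ 1 0 : ℝ) * x = γ 0 0 - γ 1 1 := by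
      have : ((γ 0 0 : ℝ) - (2 * γ 1 0 * x + γ 1 1)) * y = 0 := by nlinarith [hI]
      rcases mul_eq_zero.mp this with h | h
      · linarith
      · exact absurd h hypos.ne'
    have hdetR : (γ 0 0 : ℝ) * γ 1 1 - γ 0 1 * γ 1 0 = 1 := by exact_mod_cast hdet
    have key : 4 * (γ 1 0 : ℝ) ^ 2 * y ^ 2 = 4 - ((γ 0 0 : ℝ) + γ 1 1) ^ 2 := by
      have h4 : 4 * (γ 1 0 : ℝ) * ((γ 0 0 : ℝ) * x + γ 0 1) =
          4 * (γ 1 0 : ℝ) * (γ 1 0 * x ^ 2 - γ 1 0 * y ^ 2 + γ 1 1 * x) := by rw [hR]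
      nlinarith [h4, hxc, hdetR]
    have hpos : 0 < 4 * (γ 1 0 : ℝ) ^ 2 * y ^ 2 := by
      have hc' : (γ 1 0 : ℝ) ≠ 0 := by exact_mod_cast hc
      positivity
    have : ((γ 0 0 : ℝ) + γ 1 1) ^ 2 < 4 := by linarith
    exact_mod_cast this

/-- **`Γ₀(N)⁺` acts freely on `ℍ`**: an element of `Γ₀(N) ∩ Γ₁(4)` fixing a point of `ℍ` is the
identity (its trace is `≡ 2 (mod 4)`, hence `|a + d| ≥ 2`, while a non-central element with a
fixed point has `(a+d)² < 4`; and `-1 ∉ Γ₀(N)⁺`). [folklore] -/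
theorem eq_one_of_mem_Gamma0Plus_of_smul_eq {N : ℕ} {γ : SL(2, ℤ)} (hγ : γ ∈ Gamma0Plus N) {w : ℍ}
    (hfix : γ • w = w) : γ = 1 := by
  by_contra h1
  have h2 : γ ≠ -1 := by
    intro h; rw [h] at hγ; exact neg_one_not_mem_Gamma0Plus hγ
  have hlt := trace_sq_lt_four_of_smul_eq hfix h1 h2
  have htr := trace_mod_four_of_mem_Gamma1 (Subgroup.mem_inf.mp hγ).2
  -- `t ≡ 2 (mod 4)` and `t² < 4` is impossible
  have hrange : -1 ≤ (γ 0 0 + γ 1 1 : ℤ) ∧ (γ 0 0 + γ 1 1 : ℤ) ≤ 1 := by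
    constructor <;> nlinarith
  have hmod : (γ 0 0 + γ 1 1 : ℤ) % 4 = 2 := by
    have := (ZMod.intCast_eq_intCast_iff' (γ 0 0 + γ 1 1) 2 4).mp (by rw [htr]; rfl)
    simpa using this
  omega

/-- The stabiliser in `Γ₀(N)⁺` of a point of `ℍ` is trivial. [folklore] -/
theorem stabilizer_Gamma0Plus_eq_bot {N : ℕ} (w : ℍ) :
    MulAction.stabilizer (Gamma0Plus N) w = ⊥ := by
  rw [Subgroup.eq_bot_iff_forall]
  intro γ hγ
  rw [MulAction.mem_stabilizer_iff] at hγ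
  have : (γ : SL(2, ℤ)) • w = w := hγ
  exact Subtype.ext (eq_one_of_mem_Gamma0Plus_of_smul_eq γ.2 this)

end Literature.NumberTheory.EllipticCurves.ModularForms
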